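import Literature.NumberTheory.Automorphic.QuaternionAdelicTorus
import Mathlib.LinearAlgebra.Matrix.Charpoly.Minpoly
import Mathlib.FieldTheory.Minpoly.Field
import Mathlib.RingTheory.PrincipalIdealDomain
import Mathlib.Algebra.Central.Matrix
import HarnessLib

/-!
# Elliptic tori without the division hypothesis: `C_D(γ) = K[γ]` and the compactness of
`K(γ)_𝔸ˣ ⧸ ℝ_{>0} K(γ)ˣ` inside `D_𝔸ˣ` for `K[γ]` a field — in particular for the elliptic
regular elements of `GL₂(K) = M₂(K)ˣ`
(Gelbart, *Automorphic forms on adele groups* (1975), Thm. 9.22 (ii) and Remark 9.23;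
Jacquet–Langlands (1970), §16)

Topic `NumberTheory/Automorphic`; theorems only (no definition, no named fact, no instance).
`QuaternionAlgebraCentralizer` and `QuaternionAdelicTorus` prove, for a central `K`-algebra `D`
of dimension `4` **in which every non-zero element is invertible** and `γ ∈ Dˣ ∖ K`, that
`C_D(γ) = K[γ]` is a quadratic field, that the adelic centraliser `C_{D_𝔸ˣ}(γ)` is the abelian
torus `K(γ)_𝔸ˣ` and that `C_{D_𝔸ˣ}(γ) ⧸ (ℝ_{>0} Dˣ ∩ C_{D_𝔸ˣ}(γ))` is compact (Fujisaki for the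
field `K(γ)`). In the trace formula for `GL₂` (Gelbart Thm. 9.22 (ii): the elliptic terms
`Σ_{γ ∈ G_e} meas(Z_∞⁺ G(γ)_ℚ \ G(γ)_𝔸) ∫_{G(γ)_𝔸 \ G_𝔸} f(x⁻¹ γ x) dx` "are reminiscent of the
formulas which obtain in the case of compact quotient", Remark 9.23) the same three statements
are needed for the **split** algebra `M₂(K)` and its **elliptic regular** elements `γ` — those
whose characteristic polynomial is irreducible over `K`, i.e. `K[γ]` is a quadratic field — where
the division hypothesis fails. This file removes it:

* `forall_isUnit_adjoin_singleton_of_irreducible_minpoly` — in any `K`-algebra, `K[u]` is a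
  (skew-)field as soon as the minimal polynomial of `u` is irreducible (Bezout in `K[X]`).
* `finrank_adjoin_singleton_eq_two_of_forall_isUnit`,
  `Subalgebra.centralizer_singleton_eq_adjoin_of_forall_isUnit` — for a central `K`-algebra `D`
  of dimension `4`, `u ∉ K` with `K[u]` a field: `dim_K K[u] = 2` and **`C_D(u) = K[u]`**
  (tower law over the field `K[u]`: `dim_K K[u]` and `dim_K C_D(u)` are multiples of `2`
  dividing, resp. strictly below, `4`), with the corollaries `centralizer_comm_of_forall_isUnit`,
  `forall_isUnit_centralizer_of_forall_isUnit` (the centraliser is a commutative field).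
* `Matrix.irreducible_minpoly_of_irreducible_charpoly`, `Matrix.not_mem_bot_of_irreducible_charpoly`
  — for a square matrix with irreducible characteristic polynomial (of size `> 1`) the minimal
  polynomial is irreducible and the matrix is not scalar; hence (`GL₂`)
  `forall_isUnit_adjoin_of_irreducible_charpoly`.
* `centralizer_inclAdelic_eq_range_of_comm`, `centralizer_inclAdelic_comm_of_comm`,
  `compactSpace_centralizer_quotient_of_forall_isUnit` — the three adelic statements of
  `QuaternionAdelicTorus` for an ARBITRARY finite-dimensional `K`-algebra `D` and `γ ∈ Dˣ` whose
  centraliser `T = C_D(γ)` is commutative (resp. a commutative field): `C_{D_𝔸ˣ}(γ)` is the image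
  of `T_𝔸ˣ`, is abelian, and `C_{D_𝔸ˣ}(γ) ⧸ (ℝ_{>0} Dˣ ∩ C_{D_𝔸ˣ}(γ))` is compact (proofs verbatim
  those of `QuaternionAdelicTorus`, the division hypothesis entering there only through the
  commutativity and the field property of `T`); specialisations `…_of_adjoin` (central `D` of
  dimension `4`, `K[γ]` a field) and `…_matrix` (`D = M₂(K)`, `γ ∈ GL₂(K)` with irreducible
  characteristic polynomial: Gelbart Thm. 9.22 (ii), the groups `G(γ)_𝔸` of the elliptic terms and
  the finiteness of `meas(Z_∞⁺ G(γ)_ℚ \ G(γ)_𝔸)`).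

Part of the inline (D-0026) decomposition of
`Literature.NumberTheory.Automorphic.jacquetLanglands_transfer_exists` (Gelbart Thm. 10.5 via the
comparison (10.14) = (10.15) of trace formulas; the elliptic terms of (10.15)).

## References

* S. Gelbart, *Automorphic forms on adele groups*, Ann. of Math. Studies 83 (1975), Thm. 9.22 (ii),
  Remark 9.23, p. 154 [Gelbart1975].
* H. Jacquet, R. P. Langlands, *Automorphic forms on `GL(2)`*, LNM 114 (1970), §16
  [JacquetLanglands1970].
* M.-F. Vignéras, *Arithmétique des algèbres de quaternions*, LNM 800 (1980), Ch. I §1–2,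
  Ch. III §1 Thm. 1.4 [VignerasLNM800].
-/

noncomputable section

open Module Polynomial NumberField IsDedekindDomain Topology
open scoped TensorProduct NNReal

namespace Literature.NumberTheory.Automorphic

universe u

/-! ### `K[u]` is a field when the minimal polynomial is irreducible -/

section MinpolyField

variable {K : Type*} {D : Type*} [Field K] [Ring D] [Algebra K D]

/-- **`K[u]` is a field when `minpoly_K(u)` is irreducible**: every non-zero element of the
(commutative) subalgebra `K[u]` of an arbitrary `K`-algebra is a unit of `K[u]`. Proof: an element
of `K[u]` is `f(u)`; if `f(u) ≠ 0` then `minpoly ∤ f`, so `a · minpoly + b f = 1` (Bezout for the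
irreducible `minpoly`) and `b(u)` is the inverse. [folklore] -/
theorem forall_isUnit_adjoin_singleton_of_irreducible_minpoly {u : D}
    (hirr : Irreducible (minpoly K u)) :
    ∀ x : Algebra.adjoin K {u}, x ≠ 0 → IsUnit x := by
  rintro ⟨x, hx⟩ hx0
  have hx' := hx
  rw [Algebra.adjoin_singleton_eq_range_aeval] at hx'
  obtain ⟨f, rfl⟩ := (AlgHom.mem_range _).1 hx'
  have hndvd : ¬ minpoly K u ∣ f := by
    rintro ⟨g, hg⟩
    apply hx0
    apply Subtype.ext
    change aeval u f = 0
    rw [hg, map_mul, minpoly.aeval, zero_mul]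
  obtain ⟨a, b, hab⟩ := (hirr.coprime_iff_not_dvd).2 hndvd
  have h1 : aeval u b * aeval u f = 1 := by
    have := congrArg (aeval u) hab
    rwa [map_add, map_mul, map_mul, minpoly.aeval, mul_zero, zero_add, map_one] at this
  have h2 : aeval u f * aeval u b = 1 := by
    have := congrArg (aeval u) hab
    rw [mul_comm b f] at this
    rwa [map_add, map_mul, map_mul, minpoly.aeval, mul_zero, zero_add, map_one] at this
  have hbmem : aeval u b ∈ Algebra.adjoin K {u} := by
    rw [Algebra.adjoin_singleton_eq_range_aeval]; exact ⟨b, rfl⟩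
  exact ⟨⟨⟨aeval u f, hx⟩, ⟨aeval u b, hbmem⟩, Subtype.ext h2, Subtype.ext h1⟩, rfl⟩

/-- `K[u]` is a field (as a proposition about the commutative ring `K[u]`) when `minpoly_K(u)` is
irreducible and `D ≠ 0`. [folklore] -/
theorem isField_adjoin_singleton_of_forall_isUnit [Nontrivial D] {u : D}
    (hL : ∀ x : Algebra.adjoin K {u}, x ≠ 0 → IsUnit x) : IsField (Algebra.adjoin K {u}) where
  exists_pair_ne := ⟨0, 1, fun h => zero_ne_one (congrArg Subtype.val h)⟩
  mul_comm := fun x y => Subtype.ext (Algebra.adjoin_singleton_comm (K := K) u x x.2 y y.2)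
  mul_inv_cancel := fun {a} ha => by
    obtain ⟨v, hv⟩ := hL a ha
    exact ⟨((v⁻¹ : (Algebra.adjoin K {u})ˣ) : Algebra.adjoin K {u}), by rw [← hv, Units.mul_inv]⟩

end MinpolyField

/-! ### `C_D(u) = K[u]` for `K[u]` a quadratic field, without the division hypothesis -/

section Centralizer

variable {K : Type*} {D : Type*} [Field K] [Ring D] [Algebra K D] [Algebra.IsCentral K D]

/-- **`dim_K K[u] = 2`** for `u ∉ K` with `K[u]` a field, in a central `K`-algebra `D` of dimension
`4`: `D` is a vector space over the field `K[u]`, so `dim_K K[u] ∣ 4`; it is `> 1` (`u ∉ K`) and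
`≠ 4` (`D` is not commutative, its centre being `K`). [cite: VignerasLNM800, Ch. I §1] -/
theorem finrank_adjoin_singleton_eq_two_of_forall_isUnit (h4 : finrank K D = 4) {u : D}
    (hu : u ∉ (⊥ : Subalgebra K D)) (hL : ∀ x : Algebra.adjoin K {u}, x ≠ 0 → IsUnit x) :
    finrank K (Algebra.adjoin K {u}) = 2 := by
  haveI : Nontrivial D := Module.nontrivial_of_finrank_pos (R := K) (by omega)
  haveI : FiniteDimensional K D := Module.finite_of_finrank_pos (by omega)
  set L := Algebra.adjoin K {u} with hLdef
  have hcomm := Algebra.adjoin_singleton_comm (K := K) u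
  -- lower bound: `K ⊊ K[u]`
  have hlt : (⊥ : Subalgebra K D) < L :=
    lt_of_le_of_ne bot_le fun h => hu (h ▸ Algebra.self_mem_adjoin_singleton K u)
  have h1 : finrank K (⊥ : Subalgebra K D) = 1 := Subalgebra.finrank_bot
  have h2 : finrank K (Subalgebra.toSubmodule (⊥ : Subalgebra K D)) <
      finrank K (Subalgebra.toSubmodule L) :=
    Submodule.finrank_lt_finrank_of_lt (Subalgebra.toSubmodule.lt_iff_lt.2 hlt)
  rw [Subalgebra.finrank_toSubmodule, Subalgebra.finrank_toSubmodule, h1] at h2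
  -- `dim K[u] ≠ 4`: otherwise `D = K[u]` is commutative
  have hne : finrank K L ≠ 4 := by
    intro hS4
    have htop : Subalgebra.toSubmodule L = ⊤ :=
      Submodule.eq_top_of_finrank_eq (by rw [Subalgebra.finrank_toSubmodule, hS4, h4])
    have hcen : Subalgebra.center K D = ⊤ := by
      refine eq_top_iff.mpr fun x _ ↦ Subalgebra.mem_center_iff.mpr fun y ↦ ?_
      have hx : x ∈ L := by
        rw [← Subalgebra.mem_toSubmodule, htop]; exact Submodule.mem_top
      have hy : y ∈ L := by
        rw [← Subalgebra.mem_toSubmodule, htop]; exact Submodule.mem_top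
      exact hcomm y hy x hx
    rw [Algebra.IsCentral.center_eq_bot] at hcen
    have h1' : finrank K (⊥ : Subalgebra K D) = 1 := Subalgebra.finrank_bot
    rw [hcen, ← Subalgebra.finrank_toSubmodule, Algebra.top_toSubmodule, finrank_top, h4] at h1'
    norm_num at h1'
  -- divisibility: `D` is a vector space over the field `K[u]`
  have hdvd : finrank K L ∣ 4 := by
    letI : CommRing L := { (inferInstance : Ring L) with
      mul_comm := fun x y ↦ Subtype.ext (hcomm x x.2 y y.2) }
    have hLF : IsField L := isField_adjoin_singleton_of_forall_isUnit (K := K) hL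
    letI : Field L := hLF.toField
    rw [← h4]
    exact Dvd.intro _ (Module.finrank_mul_finrank K L D)
  have hle : finrank K L ≤ 4 := Nat.le_of_dvd (by norm_num) hdvd
  interval_cases h : finrank K L <;> omega

/-- **The centraliser of `u` is `K[u]`** when `K[u]` is a field and `u ∉ K`, in a central
`K`-algebra `D` of dimension `4` (no division hypothesis on `D`; for `D = M₂(K)` these are the
elliptic regular elements). Proof: `C = C_D(u) ⊇ L = K[u]` is a left vector space over the field
`L` (`L C ⊆ C`), so `dim_K C = 2 · dim_L C`; `C ≠ D` since `u` is not central, so `dim_K C < 4`,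
forcing `dim_K C = 2 = dim_K L`. Deliberate dot-notation extension of Mathlib's `Subalgebra`
namespace. [cite: VignerasLNM800, Ch. I §1–2] -/
theorem Subalgebra.centralizer_singleton_eq_adjoin_of_forall_isUnit (h4 : finrank K D = 4)
    {u : D} (hu : u ∉ (⊥ : Subalgebra K D))
    (hL : ∀ x : Algebra.adjoin K {u}, x ≠ 0 → IsUnit x) :
    Subalgebra.centralizer K ({u} : Set D) = Algebra.adjoin K {u} := by
  haveI : Nontrivial D := Module.nontrivial_of_finrank_pos (R := K) (by omega)
  haveI : FiniteDimensional K D := Module.finite_of_finrank_pos (by omega)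
  set L := Algebra.adjoin K {u} with hLdef
  set C := Subalgebra.centralizer K ({u} : Set D) with hCdef
  have hLC : L ≤ C := Algebra.adjoin_singleton_le_centralizer u
  have h2 : finrank K L = 2 := finrank_adjoin_singleton_eq_two_of_forall_isUnit h4 hu hL
  have hcomm := Algebra.adjoin_singleton_comm (K := K) u
  -- `C ≠ D`: `u` is not central
  have hC4 : finrank K C < 4 := by
    have hle : finrank K (Subalgebra.toSubmodule C) ≤ finrank K D := Submodule.finrank_le _
    rw [Subalgebra.finrank_toSubmodule, h4] at hle
    refine lt_of_le_of_ne hle fun hC => hu ?_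
    have htop : Subalgebra.toSubmodule C = ⊤ :=
      Submodule.eq_top_of_finrank_eq (by rw [Subalgebra.finrank_toSubmodule, hC, h4])
    have hcen : u ∈ Subalgebra.center K D := by
      rw [Subalgebra.mem_center_iff]
      intro y
      have hy : y ∈ C := by
        rw [← Subalgebra.mem_toSubmodule, htop]; exact Submodule.mem_top
      exact ((Subalgebra.mem_centralizer_iff K).1 hy u rfl).symm
    rwa [Algebra.IsCentral.center_eq_bot] at hcen
  -- the field `L` and `C` as an `L`-vector space
  letI : CommRing L := { (inferInstance : Ring L) with
    mul_comm := fun x y ↦ Subtype.ext (hcomm x x.2 y y.2) }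
  have hLF : IsField L := isField_adjoin_singleton_of_forall_isUnit (K := K) hL
  letI : Field L := hLF.toField
  let CL : Submodule L D :=
    { carrier := C
      add_mem' := fun ha hb => C.add_mem ha hb
      zero_mem' := C.zero_mem
      smul_mem' := fun l x hx => C.mul_mem (hLC l.2) hx }
  haveI : Module.Free L CL := Module.Free.of_divisionRing L CL
  haveI : Module.Free K L := Module.Free.of_divisionRing K L
  have htower : finrank K L * finrank L CL = finrank K CL := Module.finrank_mul_finrank K L CL
  let e : CL ≃ₗ[K] Subalgebra.toSubmodule C :=
    { toFun := fun x => ⟨x.1, x.2⟩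
      invFun := fun x => ⟨x.1, x.2⟩
      map_add' := fun _ _ => rfl
      map_smul' := fun _ _ => rfl
      left_inv := fun _ => rfl
      right_inv := fun _ => rfl }
  have hKC : finrank K CL = finrank K C := by
    rw [e.finrank_eq, Subalgebra.finrank_toSubmodule]
  rw [hKC, h2] at htower
  -- `2 ∣ dim C`, `2 ≤ dim C < 4` ⇒ `dim C = 2`
  have hCge : finrank K L ≤ finrank K C := by
    have := Submodule.finrank_mono (Subalgebra.toSubmodule.monotone hLC)
    rwa [Subalgebra.finrank_toSubmodule, Subalgebra.finrank_toSubmodule] at this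
  rw [h2] at hCge
  have hC2 : finrank K C = 2 := by omega
  -- equal dimensions and `L ≤ C`
  symm
  have hsub : Subalgebra.toSubmodule L = Subalgebra.toSubmodule C :=
    Submodule.eq_of_le_of_finrank_eq (Subalgebra.toSubmodule.monotone hLC)
      (by rw [Subalgebra.finrank_toSubmodule, Subalgebra.finrank_toSubmodule, h2, hC2])
  exact Subalgebra.toSubmodule_injective hsub

/-- `C_D(γ)` is commutative for `γ ∉ K` with `K[γ]` a field (it equals `K[γ]`).
[cite: VignerasLNM800, Ch. I §1] -/
theorem centralizer_comm_of_forall_isUnit (h4 : finrank K D = 4) {γ : D}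
    (hγ : γ ∉ (⊥ : Subalgebra K D)) (hL : ∀ x : Algebra.adjoin K {γ}, x ≠ 0 → IsUnit x) :
    ∀ x ∈ Subalgebra.centralizer K ({γ} : Set D), ∀ y ∈ Subalgebra.centralizer K ({γ} : Set D),
      x * y = y * x := by
  rw [Subalgebra.centralizer_singleton_eq_adjoin_of_forall_isUnit h4 hγ hL]
  exact Algebra.adjoin_singleton_comm (K := K) γ

/-- Every non-zero element of `C_D(γ) = K[γ]` is a unit of `C_D(γ)`, for `γ ∉ K` with `K[γ]` a
field. [folklore] -/
theorem forall_isUnit_centralizer_of_forall_isUnit (h4 : finrank K D = 4) {γ : D}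
    (hγ : γ ∉ (⊥ : Subalgebra K D)) (hL : ∀ x : Algebra.adjoin K {γ}, x ≠ 0 → IsUnit x) :
    ∀ x : Subalgebra.centralizer K ({γ} : Set D), x ≠ 0 → IsUnit x := by
  have h := Subalgebra.centralizer_singleton_eq_adjoin_of_forall_isUnit h4 hγ hL
  intro x hx
  set e := Subalgebra.equivOfEq _ _ h with he
  have hx' : e x ≠ 0 := fun h0 => hx (e.injective (by rw [h0, map_zero]))
  have h1 := (hL (e x) hx').map e.symm
  rwa [AlgEquiv.symm_apply_apply] at h1

end Centralizer

/-! ### Matrices with irreducible characteristic polynomial -/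

section Matrix

variable {n : Type*} [Fintype n] [DecidableEq n] {K : Type*} [Field K]

/-- **Irreducible characteristic polynomial ⇒ irreducible minimal polynomial** (the minimal
polynomial divides the characteristic polynomial, Mathlib `Matrix.minpoly_dvd_charpoly`, and is
not a unit, so the two are associated). Deliberate dot-notation extension of Mathlib's `Matrix`
namespace. [folklore] -/
theorem Matrix.irreducible_minpoly_of_irreducible_charpoly [Nonempty n] {M : Matrix n n K}
    (h : Irreducible M.charpoly) : Irreducible (minpoly K M) := by
  obtain ⟨g, hg⟩ := Matrix.minpoly_dvd_charpoly M
  have hu : IsUnit g := by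
    rcases h.isUnit_or_isUnit hg with hm | hg'
    · exact absurd hm (minpoly.not_isUnit K M)
    · exact hg'
  have hassoc : Associated (minpoly K M) M.charpoly := ⟨hu.unit, by rw [IsUnit.unit_spec, hg]⟩
  exact hassoc.irreducible_iff.2 h

/-- **A matrix of size `> 1` with irreducible characteristic polynomial is not scalar**: for
`M = c · 1`, Cayley–Hamilton gives `χ_M(c) = 0`, and an irreducible polynomial with a root has
degree `1`. [folklore] -/
theorem Matrix.not_mem_bot_of_irreducible_charpoly [Nonempty n] {M : Matrix n n K}
    (h : Irreducible M.charpoly) (hn : 1 < Fintype.card n) :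
    M ∉ (⊥ : Subalgebra K (Matrix n n K)) := by
  intro hM
  rw [Algebra.mem_bot] at hM
  obtain ⟨c, hc⟩ := hM
  have hCH : aeval (algebraMap K (Matrix n n K) c) M.charpoly = 0 := by
    rw [hc]; exact Matrix.aeval_self_charpoly M
  rw [Polynomial.aeval_algebraMap_apply_eq_algebraMap_eval, map_eq_zero_iff _
    (algebraMap K (Matrix n n K)).injective] at hCH
  have hdeg := Polynomial.degree_eq_one_of_irreducible_of_root h (Polynomial.IsRoot.def.2 hCH)
  rw [Matrix.charpoly_degree_eq_dim] at hdeg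
  norm_cast at hdeg
  omega

/-- For `γ ∈ GL_n(K)` (`n > 1`) with irreducible characteristic polynomial — an **elliptic regular**
element — `K[γ]` is a field and `γ ∉ K`. [folklore] -/
theorem forall_isUnit_adjoin_of_irreducible_charpoly [Nonempty n] {γ : Matrix n n K}
    (h : Irreducible γ.charpoly) :
    ∀ x : Algebra.adjoin K {γ}, x ≠ 0 → IsUnit x :=
  forall_isUnit_adjoin_singleton_of_irreducible_minpoly
    (Matrix.irreducible_minpoly_of_irreducible_charpoly h)

end Matrix

/-! ### The adelic torus of an element with commutative (field) centraliser -/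

section Torus

variable (K : Type) [Field K] [NumberField K] (D : Type u) [Ring D] [Algebra K D]

/-- **The adelic centraliser is the adelic torus**, division-free form: for `γ ∈ Dˣ` in a
finite-dimensional `K`-algebra `D` whose centraliser `T = C_D(γ)` is *commutative*, the centraliser
of `γ` in `D_𝔸ˣ = (𝔸_K ⊗_K D)ˣ` is the image of `T_𝔸ˣ = (𝔸_K ⊗_K T)ˣ` under `unitsMapRight K D T.val`
(`C_{𝔸 ⊗ D}(1 ⊗ γ) = 𝔸 ⊗ C_D(γ)`, Mathlib
`Subalgebra.centralizer_coe_image_includeRight_eq_center_tensorProduct`, plus injectivity of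
`𝔸 ⊗ T → 𝔸 ⊗ D` to lift units; `𝔸 ⊗ T` is commutative). For `D = M₂(K)` and `γ` elliptic this is
Gelbart's `G(γ)_𝔸 = E_𝔸ˣ`, `E = K(γ)` (Thm. 9.22 (ii), p. 154). [cite: Gelbart1975, Remark 9.23] -/
theorem centralizer_inclAdelic_eq_range_of_comm (γ : Dˣ)
    (hTc : ∀ x ∈ Subalgebra.centralizer K ({(γ : D)} : Set D),
      ∀ y ∈ Subalgebra.centralizer K ({(γ : D)} : Set D), x * y = y * x) :
    Subgroup.centralizer ({inclAdelic K D γ} : Set (adelicUnits K D)) =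
      (unitsMapRight K D (Subalgebra.centralizer K ({(γ : D)} : Set D)).val).range := by
  set T := Subalgebra.centralizer K ({(γ : D)} : Set D) with hT
  set φ := unitsMapRight K D T.val with hφ
  have hγT : (γ : D) ∈ T := (Subalgebra.mem_centralizer_iff K).2 fun g hg => by
    rw [Set.mem_singleton_iff] at hg; subst hg; rfl
  have hcommA := ScalarExtension.mul_comm_of_comm K (AdeleRing (𝓞 K) K)
    (D' := T) (fun x y => Subtype.ext (hTc x x.2 y y.2))
  have hinclγ : ((inclAdelic K D γ : adelicUnits K D) : ScalarExtension K (AdeleRing (𝓞 K) K) D) =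
      ScalarExtension.mapRight K (AdeleRing (𝓞 K) K) T.val
        (ScalarExtension.incl K (AdeleRing (𝓞 K) K) T ⟨γ, hγT⟩) := by
    rw [ScalarExtension.mapRight_incl]; rfl
  apply le_antisymm
  · intro u hu
    rw [Subgroup.mem_centralizer_iff] at hu
    simp only [Set.mem_singleton_iff, forall_eq] at hu
    have hagree : ∀ z : AdeleRing (𝓞 K) K ⊗[K] T,
        Algebra.TensorProduct.map (AlgHom.id (AdeleRing (𝓞 K) K) (AdeleRing (𝓞 K) K)) T.val z =
          Algebra.TensorProduct.map (AlgHom.id K (AdeleRing (𝓞 K) K)) T.val z := by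
      intro z
      induction z using TensorProduct.induction_on with
      | zero => simp only [map_zero]
      | tmul r x => rw [Algebra.TensorProduct.map_tmul, Algebra.TensorProduct.map_tmul]; rfl
      | add a b ha hb => rw [map_add, map_add, ha, hb]
    have key : ∀ v : adelicUnits K D, inclAdelic K D γ * v = v * inclAdelic K D γ →
        ∃ z : ScalarExtension K (AdeleRing (𝓞 K) K) T,
          ScalarExtension.mapRight K (AdeleRing (𝓞 K) K) T.val z = v := by
      intro v hv
      set v' : AdeleRing (𝓞 K) K ⊗[K] D :=
        (show AdeleRing (𝓞 K) K ⊗[K] D from (v : ScalarExtension K (AdeleRing (𝓞 K) K) D))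
        with hv'def
      have hv' : v' ∈ Subalgebra.centralizer K
          (Algebra.TensorProduct.includeRight '' ({(γ : D)} : Set D) :
            Set (AdeleRing (𝓞 K) K ⊗[K] D)) := by
        rw [Subalgebra.mem_centralizer_iff]
        rintro _ ⟨d, hd, rfl⟩
        rw [Set.mem_singleton_iff] at hd
        subst hd
        exact congrArg Units.val hv
      rw [Subalgebra.centralizer_coe_image_includeRight_eq_center_tensorProduct] at hv'
      obtain ⟨z, hz⟩ := (AlgHom.mem_range _).1 hv'
      refine ⟨z, ?_⟩
      change Algebra.TensorProduct.map (AlgHom.id (AdeleRing (𝓞 K) K) (AdeleRing (𝓞 K) K))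
        T.val z = v'
      rw [hagree, hz]
    obtain ⟨z, hz⟩ := key u hu
    have hu' : inclAdelic K D γ * u⁻¹ = u⁻¹ * inclAdelic K D γ := by
      calc inclAdelic K D γ * u⁻¹ = u⁻¹ * (u * inclAdelic K D γ) * u⁻¹ := by group
        _ = u⁻¹ * (inclAdelic K D γ * u) * u⁻¹ := by rw [hu]
        _ = u⁻¹ * inclAdelic K D γ := by group
    obtain ⟨z', hz'⟩ := key u⁻¹ hu'
    have hinj := ScalarExtension.mapRight_injective K (AdeleRing (𝓞 K) K) T.val
      Subtype.val_injective
    have h1 : z * z' = 1 := hinj (by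
      rw [map_mul, hz, hz', map_one, ← Units.val_mul, mul_inv_cancel, Units.val_one])
    have h2 : z' * z = 1 := hinj (by
      rw [map_mul, hz, hz', map_one, ← Units.val_mul, inv_mul_cancel, Units.val_one])
    exact ⟨⟨z, z', h1, h2⟩, Units.ext hz⟩
  · rintro _ ⟨w, rfl⟩
    rw [Subgroup.mem_centralizer_iff]
    simp only [Set.mem_singleton_iff, forall_eq]
    ext1
    rw [Units.val_mul, Units.val_mul, val_unitsMapRight, hinclγ, ← map_mul, ← map_mul, hcommA]

/-- **The adelic centraliser of an element with commutative centraliser is abelian** (it is the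
torus `T_𝔸ˣ`). [cite: Gelbart1975, Remark 9.23] -/
theorem centralizer_inclAdelic_comm_of_comm (γ : Dˣ)
    (hTc : ∀ x ∈ Subalgebra.centralizer K ({(γ : D)} : Set D),
      ∀ y ∈ Subalgebra.centralizer K ({(γ : D)} : Set D), x * y = y * x) :
    ∀ x ∈ Subgroup.centralizer ({inclAdelic K D γ} : Set (adelicUnits K D)),
      ∀ y ∈ Subgroup.centralizer ({inclAdelic K D γ} : Set (adelicUnits K D)), x * y = y * x := by
  rw [centralizer_inclAdelic_eq_range_of_comm K D γ hTc]
  rintro _ ⟨w, rfl⟩ _ ⟨w', rfl⟩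
  rw [← map_mul, ← map_mul]
  congr 1
  ext1
  rw [Units.val_mul, Units.val_mul]
  exact ScalarExtension.mul_comm_of_comm K _ (fun x y => Subtype.ext (hTc x x.2 y y.2)) _ _

/-- **Compactness of `G_γ ⧸ (ℝ_{>0} Dˣ ∩ G_γ)`, division-free form** (Gelbart (1975), Thm. 9.22
(ii) and p. 154: the volume factors `meas(Z_∞⁺ G(γ)_ℚ \ G(γ)_𝔸)` of the elliptic terms are finite,
`G(γ)_𝔸 = E_𝔸ˣ` being the idele group of the quadratic field `E = K(γ)`). For `γ ∈ Dˣ` in a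
finite-dimensional `K`-algebra `D` over a number field whose centraliser `T = C_D(γ)` is a
commutative field, the quotient of `G_γ = C_{D_𝔸ˣ}(γ)` by its intersection with `ℝ_{>0} · Dˣ` is
compact: the continuous image of the automorphic quotient of `T`, compact by Fujisaki
(`AdelicGroupData.compactSpace_automorphicQuotient_units_of_forall_isUnit`), under the map induced
by `unitsMapRight K D T.val` (onto `G_γ` by `centralizer_inclAdelic_eq_range_of_comm`, mapping
`ℝ_{>0} Tˣ` into `ℝ_{>0} Dˣ`). Proof verbatim that of `compactSpace_centralizer_quotient`.
[cite: Gelbart1975, Thm. 9.22 (ii) and Remark 9.23] -/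
theorem compactSpace_centralizer_quotient_of_forall_isUnit [Module.Finite K D] [Nontrivial D]
    (γ : Dˣ)
    (hTc : ∀ x ∈ Subalgebra.centralizer K ({(γ : D)} : Set D),
      ∀ y ∈ Subalgebra.centralizer K ({(γ : D)} : Set D), x * y = y * x)
    (hTu : ∀ x : Subalgebra.centralizer K ({(γ : D)} : Set D), x ≠ 0 → IsUnit x) :
    CompactSpace (↥(Subgroup.centralizer ({inclAdelic K D γ} : Set (adelicUnits K D))) ⧸
      ((AdelicGroupData.units K D).quotientSubgroup ⊓
        Subgroup.centralizer ({inclAdelic K D γ} : Set (adelicUnits K D))).subgroupOf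
        (Subgroup.centralizer ({inclAdelic K D γ} : Set (adelicUnits K D)))) := by
  set T := Subalgebra.centralizer K ({(γ : D)} : Set D) with hT
  set Gγ := Subgroup.centralizer ({inclAdelic K D γ} : Set (adelicUnits K D)) with hG
  set M : Subgroup Gγ := ((AdelicGroupData.units K D).quotientSubgroup ⊓ Gγ).subgroupOf Gγ
    with hM
  have hc : CompactSpace (AdelicGroupData.units K T).automorphicQuotient :=
    AdelicGroupData.compactSpace_automorphicQuotient_units_of_forall_isUnit K T hTu
  haveI : CompactSpace (adelicUnits K T ⧸ (AdelicGroupData.units K T).quotientSubgroup) := hc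
  set φ := unitsMapRight K D T.val with hφ
  have hrange : Gγ = φ.range := centralizer_inclAdelic_eq_range_of_comm K D γ hTc
  have hmem : ∀ w, φ w ∈ Gγ := fun w => by rw [hrange]; exact ⟨w, rfl⟩
  set φ' : adelicUnits K T → Gγ := fun w => ⟨φ w, hmem w⟩ with hφ'
  have hφ'c : Continuous φ' := (continuous_unitsMapRight K D T.val).subtype_mk _
  have hφ's : Function.Surjective φ' := by
    rintro ⟨g, hg⟩
    rw [hrange] at hg
    obtain ⟨w, rfl⟩ := hg
    exact ⟨w, rfl⟩
  have hcompat : ∀ a b : adelicUnits K T,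
      QuotientGroup.leftRel (AdelicGroupData.units K T).quotientSubgroup a b →
        QuotientGroup.leftRel M (φ' a) (φ' b) := by
    intro a b hab
    rw [QuotientGroup.leftRel_apply] at hab ⊢
    refine Subgroup.mem_subgroupOf.2 (Subgroup.mem_inf.2 ⟨?_, Gγ.mul_mem (Gγ.inv_mem (φ' a).2) (φ' b).2⟩)
    change (φ a)⁻¹ * φ b ∈ (AdelicGroupData.units K D).quotientSubgroup
    rw [← map_inv, ← map_mul]
    exact map_quotientSubgroup_units_le K D T.val ⟨a⁻¹ * b, hab, rfl⟩
  set ψ : adelicUnits K T ⧸ (AdelicGroupData.units K T).quotientSubgroup → Gγ ⧸ M :=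
    Quotient.map' φ' hcompat with hψ
  have hψc : Continuous ψ := by
    have hq : IsOpenQuotientMap (QuotientGroup.mk : (AdelicGroupData.units K T).Adelic →
        (AdelicGroupData.units K T).Adelic ⧸ (AdelicGroupData.units K T).quotientSubgroup) :=
      QuotientGroup.isOpenQuotientMap_mk
    have h : Continuous (ψ ∘ (QuotientGroup.mk : (AdelicGroupData.units K T).Adelic →
        (AdelicGroupData.units K T).Adelic ⧸ (AdelicGroupData.units K T).quotientSubgroup)) :=
      (QuotientGroup.continuous_mk (N := M)).comp hφ'c
    exact hq.continuous_comp_iff.1 h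
  have hψs : Function.Surjective ψ := by
    intro q
    induction q using QuotientGroup.induction_on with
    | H g =>
      obtain ⟨w, rfl⟩ := hφ's g
      exact ⟨QuotientGroup.mk w, rfl⟩
  exact hψs.compactSpace hψc

end Torus

/-! ### Specialisations: `K[γ]` a quadratic field in a central algebra of dimension `4`; `GL₂` -/

section Elliptic

variable (K : Type) [Field K] [NumberField K] (D : Type u) [Ring D] [Algebra K D]
  [Algebra.IsCentral K D]

/-- `C_{D_𝔸ˣ}(γ)` is the image of the torus `K(γ)_𝔸ˣ` for `γ ∉ K` with `K[γ]` a field, `D` central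
of dimension `4` (division or split). [cite: Gelbart1975, Remark 9.23] -/
theorem centralizer_inclAdelic_eq_range_of_adjoin (h4 : finrank K D = 4) (γ : Dˣ)
    (hγ : (γ : D) ∉ (⊥ : Subalgebra K D))
    (hL : ∀ x : Algebra.adjoin K {(γ : D)}, x ≠ 0 → IsUnit x) :
    Subgroup.centralizer ({inclAdelic K D γ} : Set (adelicUnits K D)) =
      (unitsMapRight K D (Subalgebra.centralizer K ({(γ : D)} : Set D)).val).range :=
  centralizer_inclAdelic_eq_range_of_comm K D γ (centralizer_comm_of_forall_isUnit h4 hγ hL)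

/-- `C_{D_𝔸ˣ}(γ)` is abelian for `γ ∉ K` with `K[γ]` a field, `D` central of dimension `4`.
[cite: Gelbart1975, Remark 9.23] -/
theorem centralizer_inclAdelic_comm_of_adjoin (h4 : finrank K D = 4) (γ : Dˣ)
    (hγ : (γ : D) ∉ (⊥ : Subalgebra K D))
    (hL : ∀ x : Algebra.adjoin K {(γ : D)}, x ≠ 0 → IsUnit x) :
    ∀ x ∈ Subgroup.centralizer ({inclAdelic K D γ} : Set (adelicUnits K D)),
      ∀ y ∈ Subgroup.centralizer ({inclAdelic K D γ} : Set (adelicUnits K D)), x * y = y * x :=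
  centralizer_inclAdelic_comm_of_comm K D γ (centralizer_comm_of_forall_isUnit h4 hγ hL)

/-- **`G_γ ⧸ (ℝ_{>0} Dˣ ∩ G_γ)` is compact for `γ ∉ K` with `K[γ]` a field**, `D` central of
dimension `4` over a number field, division OR split (Gelbart Thm. 9.22 (ii), Remark 9.23).
[cite: Gelbart1975, Thm. 9.22 (ii) and Remark 9.23] -/
theorem compactSpace_centralizer_quotient_of_adjoin [Module.Finite K D] (h4 : finrank K D = 4)
    (γ : Dˣ) (hγ : (γ : D) ∉ (⊥ : Subalgebra K D))
    (hL : ∀ x : Algebra.adjoin K {(γ : D)}, x ≠ 0 → IsUnit x) :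
    CompactSpace (↥(Subgroup.centralizer ({inclAdelic K D γ} : Set (adelicUnits K D))) ⧸
      ((AdelicGroupData.units K D).quotientSubgroup ⊓
        Subgroup.centralizer ({inclAdelic K D γ} : Set (adelicUnits K D))).subgroupOf
        (Subgroup.centralizer ({inclAdelic K D γ} : Set (adelicUnits K D)))) := by
  haveI : Nontrivial D := Module.nontrivial_of_finrank_pos (R := K) (by omega)
  exact compactSpace_centralizer_quotient_of_forall_isUnit K D γ
    (centralizer_comm_of_forall_isUnit h4 hγ hL) (forall_isUnit_centralizer_of_forall_isUnit h4 hγ hL)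

end Elliptic

section GL2

variable (K : Type) [Field K] [NumberField K]

omit [NumberField K] in
/-- `dim_K M₂(K) = 4`. [folklore] -/
theorem finrank_matrix_fin_two : finrank K (Matrix (Fin 2) (Fin 2) K) = 4 := by
  simp [Module.finrank_matrix]

omit [NumberField K] in
/-- **The centraliser of an elliptic regular `γ ∈ GL₂(K)` in `M₂(K)` is the quadratic field
`K[γ]`** (irreducible characteristic polynomial). [cite: Gelbart1975, Remark 9.23] -/
theorem Matrix.centralizer_eq_adjoin_of_irreducible_charpoly (γ : GL (Fin 2) K)
    (hirr : Irreducible (Matrix.charpoly (γ : Matrix (Fin 2) (Fin 2) K))) :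
    Subalgebra.centralizer K ({(γ : Matrix (Fin 2) (Fin 2) K)} : Set (Matrix (Fin 2) (Fin 2) K)) =
      Algebra.adjoin K {(γ : Matrix (Fin 2) (Fin 2) K)} :=
  Subalgebra.centralizer_singleton_eq_adjoin_of_forall_isUnit (finrank_matrix_fin_two K)
    (Matrix.not_mem_bot_of_irreducible_charpoly hirr (by simp))
    (forall_isUnit_adjoin_of_irreducible_charpoly hirr)

/-- **For an elliptic regular `γ ∈ GL₂(K)` the centraliser of `γ` in `(𝔸_K ⊗_K M₂(K))ˣ` is the
adelic torus `K(γ)_𝔸ˣ`** (Gelbart Thm. 9.22 (ii): `G(γ)_𝔸`; p. 154: `B_𝔸 = E_𝔸ˣ`).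
[cite: Gelbart1975, Thm. 9.22 (ii) and p. 154] -/
theorem Matrix.centralizer_inclAdelic_eq_range_of_irreducible_charpoly (γ : GL (Fin 2) K)
    (hirr : Irreducible (Matrix.charpoly (γ : Matrix (Fin 2) (Fin 2) K))) :
    Subgroup.centralizer ({inclAdelic K (Matrix (Fin 2) (Fin 2) K) γ} :
        Set (adelicUnits K (Matrix (Fin 2) (Fin 2) K))) =
      (unitsMapRight K (Matrix (Fin 2) (Fin 2) K) (Subalgebra.centralizer K
        ({(γ : Matrix (Fin 2) (Fin 2) K)} : Set (Matrix (Fin 2) (Fin 2) K))).val).range :=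
  centralizer_inclAdelic_eq_range_of_adjoin K (Matrix (Fin 2) (Fin 2) K) (finrank_matrix_fin_two K)
    γ (Matrix.not_mem_bot_of_irreducible_charpoly hirr (by simp))
    (forall_isUnit_adjoin_of_irreducible_charpoly hirr)

/-- For an elliptic regular `γ ∈ GL₂(K)` the centraliser of `γ` in `(𝔸_K ⊗_K M₂(K))ˣ` is abelian.
[cite: Gelbart1975, Thm. 9.22 (ii)] -/
theorem Matrix.centralizer_inclAdelic_comm_of_irreducible_charpoly (γ : GL (Fin 2) K)
    (hirr : Irreducible (Matrix.charpoly (γ : Matrix (Fin 2) (Fin 2) K))) :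
    ∀ x ∈ Subgroup.centralizer ({inclAdelic K (Matrix (Fin 2) (Fin 2) K) γ} :
        Set (adelicUnits K (Matrix (Fin 2) (Fin 2) K))),
      ∀ y ∈ Subgroup.centralizer ({inclAdelic K (Matrix (Fin 2) (Fin 2) K) γ} :
        Set (adelicUnits K (Matrix (Fin 2) (Fin 2) K))), x * y = y * x :=
  centralizer_inclAdelic_comm_of_adjoin K (Matrix (Fin 2) (Fin 2) K) (finrank_matrix_fin_two K) γ
    (Matrix.not_mem_bot_of_irreducible_charpoly hirr (by simp))
    (forall_isUnit_adjoin_of_irreducible_charpoly hirr)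

/-- **Compactness of `G(γ)_𝔸 ⧸ (ℝ_{>0} GL₂(K) ∩ G(γ)_𝔸)` for an elliptic regular `γ ∈ GL₂(K)`**,
inside the adelic unit group `(𝔸_K ⊗_K M₂(K))ˣ` of the split quaternion algebra (Gelbart Thm. 9.22
(ii): the elliptic volume factors `meas(Z_∞⁺ G(γ)_ℚ \ G(γ)_𝔸)` are finite). The transport to
`GL₂(𝔸_K)` along `(𝔸_K ⊗ M₂(K))ˣ ≃ GL₂(𝔸_K)` is not performed here.
[cite: Gelbart1975, Thm. 9.22 (ii)] -/
theorem Matrix.compactSpace_centralizer_quotient_of_irreducible_charpoly (γ : GL (Fin 2) K)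
    (hirr : Irreducible (Matrix.charpoly (γ : Matrix (Fin 2) (Fin 2) K))) :
    CompactSpace (↥(Subgroup.centralizer ({inclAdelic K (Matrix (Fin 2) (Fin 2) K) γ} :
        Set (adelicUnits K (Matrix (Fin 2) (Fin 2) K)))) ⧸
      ((AdelicGroupData.units K (Matrix (Fin 2) (Fin 2) K)).quotientSubgroup ⊓
        Subgroup.centralizer ({inclAdelic K (Matrix (Fin 2) (Fin 2) K) γ} :
          Set (adelicUnits K (Matrix (Fin 2) (Fin 2) K)))).subgroupOf
        (Subgroup.centralizer ({inclAdelic K (Matrix (Fin 2) (Fin 2) K) γ} :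
          Set (adelicUnits K (Matrix (Fin 2) (Fin 2) K))))) :=
  compactSpace_centralizer_quotient_of_adjoin K (Matrix (Fin 2) (Fin 2) K) (finrank_matrix_fin_two K)
    γ (Matrix.not_mem_bot_of_irreducible_charpoly hirr (by simp))
    (forall_isUnit_adjoin_of_irreducible_charpoly hirr)

end GL2

end Literature.NumberTheory.Automorphic
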